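import Summits.CriticalPhenomena.SAWScalingLimit.Theorems.SAWMassiveIsingTiltLatticeUniversalityAllFormRelay
import Summits.CriticalPhenomena.SAWScalingLimit.Theorems.SAWPhaseRetrievalHexTransferOfLatticeUniversality
import Summits.CriticalPhenomena.SAWScalingLimit.Theorems.SAWCompassLatticeCompassSLEYbCriterion
import Literature.Probability.RandomPlanarGeometry.LocalMartingaleProofs
import Mathlib.MeasureTheory.Measure.Portmanteau
import HarnessLib

/-!
# Crux `LatticeUniversality` (stmt-CriticalPhenomena-0807), line `registered` (birth v3.4) — the CONVERGENT
# upgrade: under (A) the relay needs no tightness, and ONE hex-only kernel serves cruxes 0807 AND 14221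

Line lead c3 (prover-line-stmt-CriticalPhenomena-0807-c3-0, 2026-08-17), `--supports stmt-CriticalPhenomena-0807`.

The registered skeleton (`Cruxes/LatticeUniversality/Lines/birth.lean` v3.4) closes the crux from FOUR open
statements (kernel-checked, `latticeUniversality_of_allFormRelay`, p150118):

  `HexTight` (= stmt-5423) → K2∀ (`stub_hexMicroRobustAll`, the promoted research kernel) →
  `ThirdToSquareRobustBL` (⇐ stmt-16995 ∧ stmt-16963, p144803) → `YBtoUniform` (= stmt-16966) → `LatticeUniversality`.

The tightness crux enters at ONE place: the bounded-Lipschitz merging produced by the relay is upgraded to merging on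
all bounded continuous test functions by the one-sided Prokhorov argument (`stub_mergingUpgrade`, p144690). This file
records the second way to make that upgrade, and what it buys:

* `tendsto_integral_sub_of_tendstoLaw` — **convergent upgrade** (generic, on `CurveClass ℂ`): if the second family
  CONVERGES in law to a probability law and the two families merge on bounded `1`-Lipschitz functions, they merge on
  all bounded continuous functions. No tightness, no subsequence: the first family converges to the same limit on
  bounded Lipschitz functions, hence weakly (Mathlib's bounded-Lipschitz portmanteau
  `tendsto_iff_forall_lipschitz_integral_tendsto`), hence on `C_b`.
* `latticeUniversality_of_hexConjecture_of_allForm` — **`HexSAWScalingLimit → K2∀ → ThirdToSquareRobustBL →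
  YBtoUniform → LatticeUniversality`**: under (A) (= DCS 2012 Conjecture 1, `HexSAWScalingLimit`, item stmt-0808)
  the hexagonal side of the relay converges, so the crux follows from the line's three other open statements
  WITHOUT `HexTight`.
* `hexTransfer_of_allForm` (+ the three sibling copies) — hence the sibling crux `HexTransfer`
  (stmt-CriticalPhenomena-14221, `= HexSAWScalingLimit → SAWScalingLimit`, `hexTransfer_iff_imp` p106915) follows from
  **K2∀ → ThirdToSquareRobustBL → YBtoUniform** alone, and (`hexTransfer_of_allForm_trackTransport`) from
  **K2∀ → YBLimitExists → AngleUniversality → YBtoUniform** (stmt-16995, 16963, 16966): the SAME hex-only kernel K2∀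
  that this line promoted for 0807 closes 14221's hexagonal end too — with the half-period shift carried on the
  Glazman–Manolescu side by `RL`'s moving domains, 14221 needs neither its own (A)-conditional face-robustness stub
  (`Cruxes/HexTransfer/Lines/yb_relay.lean` v6 `stub_hexFaceRobustExists`) nor any tightness item.
* `latticeUniversality_of_hexConjecture_of_allForm_trackTransport` — the 0807 version over SAWTrackTransport's items.

Consequence for the planners (one filing decision for two cruxes): 14221 ⇐ {K2∀, 16995 ∧ 16963, 16966};
0807 ⇐ the same ∪ {5423} (p150118), or ⇐ the same ∪ {(A)} (this file + `latticeUniversality_of_hexTransfer`).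
-/

noncomputable section

namespace Summit.CriticalPhenomena.SAWScalingLimit.Cruxes.LatticeUniversality.Birth

open MeasureTheory Filter Topology Set
open scoped NNReal ENNReal BoundedContinuousFunction
open Complex (I I_ne_zero)
open Literature.Probability.RandomPlanarGeometry
open Literature.Probability.RandomPlanarGeometry.SAW
open Literature.Probability.RandomPlanarGeometry.SAW.YangBaxter
open Literature.Probability.LatticeModels (Site HexVertex hexGraph hexCenter)
open Summit.CriticalPhenomena.SAWScalingLimit.Theses
open Summit.CriticalPhenomena.SAWScalingLimit.Cruxes.HexTransfer.YbRelay (third IsBdryEdge bdryVertex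
  faceDomain gmSimilarity)

/-! ### Generic: bounded-Lipschitz merging against a CONVERGENT family is merging on `C_b` -/

section Generic

variable {Ω₁ Ω₂ : ℝ → Type*} [∀ δ, MeasurableSpace (Ω₁ δ)] [∀ δ, MeasurableSpace (Ω₂ δ)]
  {Ω' : Type*} [MeasurableSpace Ω']

/-- **Convergent upgrade.** Let `X δ` (under laws `P δ`, probability measures for small `δ`, `X δ` measurable)
and `Y δ` (under `Q δ`) be random curve classes, and suppose `Y δ → Z` in law along `δ → 0⁺` (`TendstoLaw`,
`Z` a.e.-measurable under a probability measure `P'`). If `E f(X δ) − E f(Y δ) → 0` for every bounded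
`1`-Lipschitz `f`, then it does so for every bounded continuous `f`. Proof: by rescaling, the `X`-integrals of
every bounded Lipschitz function converge to its `Z`-integral; by the bounded-Lipschitz portmanteau the laws of
`X δ` converge weakly to the law of `Z`; subtract the convergence of the `Y`-side. No tightness is used.
[cite: BillingsleyCPM1999, Thm. 2.1] -/
theorem tendsto_integral_sub_of_tendstoLaw
    {X : ∀ δ, Ω₁ δ → CurveClass ℂ} {Y : ∀ δ, Ω₂ δ → CurveClass ℂ}
    {P : ∀ δ, Measure (Ω₁ δ)} {Q : ∀ δ, Measure (Ω₂ δ)} {Z : Ω' → CurveClass ℂ} {P' : Measure Ω'}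
    [IsProbabilityMeasure P']
    (hP : ∀ᶠ δ in 𝓝[>] (0 : ℝ), IsProbabilityMeasure (P δ))
    (hX : ∀ δ, Measurable (X δ)) (hZ : AEMeasurable Z P')
    (hY : TendstoLaw Y Q Z P')
    (hLip : ∀ f : CurveClass ℂ →ᵇ ℝ, LipschitzWith 1 f →
      Tendsto (fun δ : ℝ => (∫ ω, f (X δ ω) ∂(P δ)) - ∫ ω, f (Y δ ω) ∂(Q δ)) (𝓝[>] (0 : ℝ)) (𝓝 0))
    (f : CurveClass ℂ →ᵇ ℝ) :
    Tendsto (fun δ : ℝ => (∫ ω, f (X δ ω) ∂(P δ)) - ∫ ω, f (Y δ ω) ∂(Q δ)) (𝓝[>] (0 : ℝ)) (𝓝 0) := by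
  classical
  -- (i) the `X`-integrals of every bounded Lipschitz function converge to its `Z`-integral
  have hA : ∀ (g : CurveClass ℂ →ᵇ ℝ) (L : ℝ≥0), LipschitzWith L g →
      Tendsto (fun δ : ℝ => ∫ ω, g (X δ ω) ∂(P δ)) (𝓝[>] (0 : ℝ)) (𝓝 (∫ ω, g (Z ω) ∂P')) := by
    intro g L hL
    -- rescale `g` to a `1`-Lipschitz function `c • g`, `c = (max L 1)⁻¹`
    set M : ℝ := ((max L 1 : ℝ≥0) : ℝ) with hM_def
    have hM1 : (1 : ℝ) ≤ M := by
      rw [hM_def]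
      exact_mod_cast le_max_right L 1
    have hMpos : 0 < M := lt_of_lt_of_le one_pos hM1
    set c : ℝ := M⁻¹ with hc_def
    have hcpos : 0 < c := inv_pos.2 hMpos
    have hc1 : c * (L : ℝ) ≤ 1 := by
      rw [hc_def, inv_mul_le_iff₀ hMpos, mul_one, hM_def]
      exact_mod_cast le_max_left L 1
    have hg1 : LipschitzWith 1 (c • g) := by
      refine LipschitzWith.of_dist_le_mul fun x y => ?_
      change dist (c * g x) (c * g y) ≤ _
      rw [Real.dist_eq, ← mul_sub, abs_mul, abs_of_pos hcpos, ← Real.dist_eq, NNReal.coe_one, one_mul]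
      calc c * dist (g x) (g y) ≤ c * ((L : ℝ) * dist x y) :=
            mul_le_mul_of_nonneg_left (hL.dist_le_mul x y) hcpos.le
        _ = (c * (L : ℝ)) * dist x y := by ring
        _ ≤ 1 * dist x y := mul_le_mul_of_nonneg_right hc1 dist_nonneg
        _ = dist x y := one_mul _
    have h1 := hLip (c • g) hg1
    have h2 := hY (c • g)
    have h3 := h1.add h2
    rw [zero_add] at h3
    have h4 : Tendsto (fun δ : ℝ => ∫ ω, (c • g) (X δ ω) ∂(P δ)) (𝓝[>] (0 : ℝ))
        (𝓝 (∫ ω, (c • g) (Z ω) ∂P')) :=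
      h3.congr fun δ => by ring
    have h5 := h4.const_mul c⁻¹
    simp only [BoundedContinuousFunction.coe_smul, smul_eq_mul, integral_const_mul,
      ← mul_assoc, inv_mul_cancel₀ hcpos.ne', one_mul] at h5
    exact h5
  -- (ii) surrogate probability laws of `X δ` on the curve space; bounded-Lipschitz portmanteau
  let μ : ProbabilityMeasure (CurveClass ℂ) := ⟨P'.map Z, Measure.isProbabilityMeasure_map hZ⟩
  let μs : ℝ → ProbabilityMeasure (CurveClass ℂ) := fun δ =>
    if h : IsProbabilityMeasure (P δ) then
      ⟨(P δ).map (X δ), by haveI := h; exact Measure.isProbabilityMeasure_map (hX δ).aemeasurable⟩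
    else μ
  have hμs : ∀ᶠ δ in 𝓝[>] (0 : ℝ),
      ((μs δ : ProbabilityMeasure (CurveClass ℂ)) : Measure (CurveClass ℂ)) = (P δ).map (X δ) := by
    filter_upwards [hP] with δ hδ
    show ((if h : IsProbabilityMeasure (P δ) then
      (⟨(P δ).map (X δ), by haveI := h; exact Measure.isProbabilityMeasure_map (hX δ).aemeasurable⟩ :
        ProbabilityMeasure (CurveClass ℂ)) else μ : ProbabilityMeasure (CurveClass ℂ)) :
        Measure (CurveClass ℂ)) = _
    rw [dif_pos hδ]
    rfl
  have hweak : Tendsto μs (𝓝[>] (0 : ℝ)) (𝓝 μ) := by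
    refine tendsto_iff_forall_lipschitz_integral_tendsto.2 fun g hgb hgl => ?_
    obtain ⟨L, hL⟩ := hgl
    let gb : CurveClass ℂ →ᵇ ℝ := ⟨⟨g, hL.continuous⟩, hgb⟩
    have h := hA gb L hL
    have hlim : ∫ ω, gb (Z ω) ∂P' = ∫ x, g x ∂(μ : Measure (CurveClass ℂ)) := by
      show ∫ ω, gb (Z ω) ∂P' = ∫ x, gb x ∂(P'.map Z)
      rw [integral_map hZ gb.continuous.aestronglyMeasurable]
    rw [hlim] at h
    refine h.congr' ?_
    filter_upwards [hμs] with δ hδ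
    rw [hδ]
    change ∫ ω, gb (X δ ω) ∂(P δ) = ∫ x, gb x ∂((P δ).map (X δ))
    rw [integral_map (hX δ).aemeasurable gb.continuous.aestronglyMeasurable]
  -- (iii) hence on `f`; subtract the `Y`-side
  have hXf : Tendsto (fun δ : ℝ => ∫ ω, f (X δ ω) ∂(P δ)) (𝓝[>] (0 : ℝ)) (𝓝 (∫ ω, f (Z ω) ∂P')) := by
    have h := (ProbabilityMeasure.tendsto_iff_forall_integral_tendsto.1 hweak) f
    have hlim : ∫ x, f x ∂(μ : Measure (CurveClass ℂ)) = ∫ ω, f (Z ω) ∂P' := by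
      show ∫ x, f x ∂(P'.map Z) = _
      rw [integral_map hZ f.continuous.aestronglyMeasurable]
    rw [hlim] at h
    refine h.congr' ?_
    filter_upwards [hμs] with δ hδ
    rw [hδ, integral_map (hX δ).aemeasurable f.continuous.aestronglyMeasurable]
  have h := hXf.sub (hY f)
  rwa [sub_self] at h

end Generic

/-! ### The relay under (A): no tightness -/

/-- **`HexSAWScalingLimit → K2∀ → ThirdToSquareRobustBL → YBtoUniform → LatticeUniversality`** — the crux from
the line's kernel, its transport stub and the toll, with the tightness crux `HexTight` (stmt-5423) REPLACED by
(A). Fix `D`, `(a, b)`, `(a', b')`, `f`; `σ z = i z`, `S_δ = σ − iδ/2`, `g = f ∘ σ⁻¹`. Square end: `∫ f∘curve dP^{ℤ²}(D)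
= ∫ g∘curve dP^{ℤ²}(σD; σa, σb)` exactly (`integral_quarterTurn`); toll in `σD` on `g`. Hexagonal end: K2∀ with the
landed shifted boundary endpoints gives the ∃-form micro-robustness (`hexMicroRobust_of_allForm`), the exact `π/3`
dictionary turns it into the convention bridge on the moving domains `S_δ(D)` (`hexThirdShiftBL_of_microRobust`), the
transport stub (at `σD`, `u δ = −iδ/2`) lands at `π/2` in `σD`; the `iδ/2` displacement is free on Lipschitz functions;
so `Q^{π/2}(σD)` and `σ_* P^{Hex}(D)` merge on bounded `1`-Lipschitz functions. Under (A), `σ_* P^{Hex}(D; a', b')`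
CONVERGES in law (to `σ ∘ Γ`, `Γ` the SLE(8/3) curve of `D`), so the convergent upgrade
(`tendsto_integral_sub_of_tendstoLaw`; GM's `π/2` law is a probability measure eventually,
`eventually_isProbabilityMeasure_ybLaw`) gives merging on `g`; and `g ∘ σ = f`. [folklore] -/
theorem latticeUniversality_of_hexConjecture_of_allForm (hA : HexSAWScalingLimit)
    (hK : (∀ (D : DobrushinDomain) (a b : ℝ → HexVertex), SAW.IsEmbEndpointApprox hexGraph hexCenter D a b → ∀ a' b' : ℝ → MidEdge, (∀ᶠ δ in 𝓝[>] (0 : ℝ), a' δ ≠ b' δ ∧ IsBdryEdge (meshFaces third (((D.map (similarity I I_ne_zero 0)).map (similarity 1 one_ne_zero (-(I * (δ : ℂ) / 2)))).carrier) δ) (a' δ) ∧ IsBdryEdge (meshFaces third (((D.map (similarity I I_ne_zero 0)).map (similarity 1 one_ne_zero (-(I * (δ : ℂ) / 2)))).carrier) δ) (b' δ) ∧ Nonempty (YangBaxterSAW third (((D.map (similarity I I_ne_zero 0)).map (similarity 1 one_ne_zero (-(I * (δ : ℂ) / 2)))).carrier) δ (a' δ) (b' δ))) → Tendsto (fun δ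 : ℝ => (δ : ℂ) * planeMidpoint third (a' δ)) (𝓝[>] (0 : ℝ)) (𝓝 ((D.map (similarity I I_ne_zero 0)).pt 0)) → Tendsto (fun δ : ℝ => (δ : ℂ) * planeMidpoint third (b' δ)) (𝓝[>] (0 : ℝ)) (𝓝 ((D.map (similarity I I_ne_zero 0)).pt 1)) → ∀ f : BoundedContinuousFunction (CurveClass ℂ) ℝ, LipschitzWith 1 f → Tendsto (fun δ : ℝ => (∫ γ, f γ.curve ∂(SAW.hexSAWLaw (faceDomain (((D.map (similarity I I_ne_zero 0)).map (similarity 1 one_ne_zero (-(I * (δ : ℂ) / 2)))).carrier) δ (a' δ)) δ (bdryVertex (meshFaces third (((D.map (similarity I I_ne_zero 0)).map (similarity 1 one_ne_zero (-(I * (δ : ℂ) / 2)))).carrier) δ) (a' δ)) (bdryVertex (meshFaces third (((D.map (similarity I I_ne_zero 0)).map (similarity 1 one_ne_zero (-(I * (δ : ℂ) / 2)))).carrier) δ) (b' δ)))) - ∫ γ, f γ.curve ∂(SAW.hexSAWLaw D.carrier δ (a δ) (b δ))) (𝓝[>] (0 : ℝ)) (𝓝 0)))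
    (h2 : (∀ (D : DobrushinDomain) (u : ℝ → ℂ) (a b : ℝ → MidEdge), (∀ᶠ δ in 𝓝[>] (0 : ℝ), ‖u δ‖ ≤ δ) → (∀ᶠ δ in 𝓝[>] (0 : ℝ), Nonempty (YangBaxterSAW (fun (_ : ℤ) => Real.pi / 3) ((D.map (similarity 1 one_ne_zero (u δ))).carrier) δ (a δ) (b δ))) → Tendsto (fun δ : ℝ => (δ : ℂ) * planeMidpoint (fun (_ : ℤ) => Real.pi / 3) (a δ)) (𝓝[>] (0 : ℝ)) (𝓝 (D.pt 0)) → Tendsto (fun δ : ℝ => (δ : ℂ) * planeMidpoint (fun (_ : ℤ) => Real.pi / 3) (b δ)) (𝓝[>] (0 : ℝ)) (𝓝 (D.pt 1)) → ∃ a' b' : ℝ → MidEdge, IsYBEndpointApprox (fun (_ : ℤ) => Real.pi / 2) D a' b' ∧ ∀ f : BoundedContinuousFunction (CurveClass ℂ) ℝ, LipschitzWith 1 f → Tendsto (fun δ : ℝ => (∫ γ, f (γ.curve (fun (_ : ℤ) => Real.pi / 3) δ) ∂(ybLaw (fun (_ : ℤ) => Real.pi / 3) ((D.map (similarity 1 one_ne_zero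 (u δ))).carrier) δ 1 (a δ) (b δ))) - ∫ γ, f (γ.curve (fun (_ : ℤ) => Real.pi / 2) δ) ∂(ybLaw (fun (_ : ℤ) => Real.pi / 2) D.carrier δ 1 (a' δ) (b' δ))) (𝓝[>] (0 : ℝ)) (𝓝 0)))
    (h3 : SAWTrackTransport.YBtoUniform) : SAWMassiveIsingTilt.LatticeUniversality := by
  intro D a b a' b' hab hab' f
  haveI : IsProbabilityMeasure Literature.Probability.Process.preWienerMeasure :=
    isProbabilityMeasure_preWienerMeasure'
  -- the rotated `δℤ²` approximation of `σD`; the relay's approximations on `S_δ(D)` and on `σD`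
  have habσ := Cruxes.HexTransfer.PinTheShear.stub_quarterTurnCovariance.2 D a b hab
  obtain ⟨a₃, b₃, hne₃, ha₃, hb₃, hH⟩ :=
    hexThirdShiftBL_of_microRobust (hexMicroRobust_of_allForm hK) D a' b' hab'
  obtain ⟨a₂, b₂, hab₂, hT⟩ := h2 (D.map (similarity I I_ne_zero 0)) (fun δ : ℝ => -(I * (δ : ℂ) / 2))
    a₃ b₃ eventually_norm_halfShift_le hne₃ ha₃ hb₃
  -- the transported test function `g = f ∘ σ⁻¹`, with `g (σ c) = f c`
  have hσL : LipschitzWith 1 (CurveClass.map (similarity I I_ne_zero 0 : C(ℂ, ℂ))) := by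
    simpa using CurveClass.lipschitzWith_map (lipschitzWith_similarity I I_ne_zero 0)
  set g : BoundedContinuousFunction (CurveClass ℂ) ℝ := f.compContinuous
    ⟨CurveClass.map (similarity (-I) (neg_ne_zero.2 I_ne_zero) 0 : C(ℂ, ℂ)),
      (CurveClass.lipschitzWith_map
        (lipschitzWith_similarity (-I) (neg_ne_zero.2 I_ne_zero) 0)).continuous⟩ with hg_def
  have hg : ∀ c, g (CurveClass.map (similarity I I_ne_zero 0 : C(ℂ, ℂ)) c) = f c := fun c => by
    simp only [hg_def, BoundedContinuousFunction.compContinuous_apply, ContinuousMap.coe_mk, map_negI_map_I]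
  -- bracket 1: the toll in `σD` on `g`
  have hZ := h3 (D.map (similarity I I_ne_zero 0)) (fun δ => ![-(a δ 1), a δ 0])
    (fun δ => ![-(b δ 1), b δ 0]) a₂ b₂ habσ hab₂ g
  -- brackets 2 + 3 + the free `iδ/2` displacement: bounded-Lipschitz merging `Q^{π/2}(σD) ↔ σ_* P^{Hex}(D)`
  have hBL : ∀ φ : BoundedContinuousFunction (CurveClass ℂ) ℝ, LipschitzWith 1 φ →
      Tendsto (fun δ : ℝ =>
          (∫ γ, φ (γ.curve (fun (_ : ℤ) => Real.pi / 2) δ)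
              ∂(ybLaw (fun (_ : ℤ) => Real.pi / 2) (D.map (similarity I I_ne_zero 0)).carrier δ 1
                  (a₂ δ) (b₂ δ))) -
            ∫ γ, φ (CurveClass.map (similarity I I_ne_zero 0 : C(ℂ, ℂ)) γ.curve)
              ∂(SAW.hexSAWLaw D.carrier δ (a' δ) (b' δ)))
        (𝓝[>] (0 : ℝ)) (𝓝 0) := by
    intro φ hφ
    -- the displacement bracket, squeezed by `δ/2`
    have hS : Tendsto (fun δ : ℝ =>
        (∫ γ, φ (CurveClass.map (gmSimilarity δ : C(ℂ, ℂ)) γ.curve)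
            ∂(SAW.hexSAWLaw D.carrier δ (a' δ) (b' δ))) -
          ∫ γ, φ (CurveClass.map (similarity I I_ne_zero 0 : C(ℂ, ℂ)) γ.curve)
            ∂(SAW.hexSAWLaw D.carrier δ (a' δ) (b' δ)))
        (𝓝[>] (0 : ℝ)) (𝓝 0) := by
      have h0 : Tendsto (fun δ : ℝ => δ / 2) (𝓝[>] (0 : ℝ)) (𝓝 0) := by
        have h : Tendsto (fun δ : ℝ => δ / 2) (𝓝 (0 : ℝ)) (𝓝 (0 / 2)) := tendsto_id.div_const 2
        rw [zero_div] at h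
        exact tendsto_nhdsWithin_of_tendsto_nhds h
      refine squeeze_zero_norm' ?_ h0
      filter_upwards [self_mem_nhdsWithin] with δ hδ
      exact le_of_eq_of_le (Real.norm_eq_abs _) (abs_integral_shift_sub_le (le_of_lt hδ) φ hφ)
    have h := ((hS.add (hH φ hφ)).sub (hT φ hφ))
    rw [add_zero, sub_zero] at h
    exact h.congr fun δ => by ring
  -- NEW: under (A) the hexagonal side converges in law (pushed along `σ`), so the convergent upgrade applies
  obtain ⟨Γ, hΓ, -, hconv⟩ := hA D a' b' hab'
  have hconvσ : TendstoLaw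
      (fun δ (γ : SAW.HexDomainSAW D.carrier δ (a' δ) (b' δ)) =>
        CurveClass.map (similarity I I_ne_zero 0 : C(ℂ, ℂ)) γ.curve)
      (fun δ => SAW.hexSAWLaw D.carrier δ (a' δ) (b' δ))
      (fun ω => CurveClass.map (similarity I I_ne_zero 0 : C(ℂ, ℂ)) (Γ ω))
      Literature.Probability.Process.preWienerMeasure := fun φ =>
    hconv (φ.compContinuous ⟨CurveClass.map (similarity I I_ne_zero 0 : C(ℂ, ℂ)), hσL.continuous⟩)
  have hPσ : ∀ᶠ δ in 𝓝[>] (0 : ℝ), IsProbabilityMeasure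
      (ybLaw (fun (_ : ℤ) => Real.pi / 2) (D.map (similarity I I_ne_zero 0)).carrier δ 1 (a₂ δ) (b₂ δ)) :=
    Theorems.SAWCompassLatticeCompassSLE.eventually_isProbabilityMeasure_ybLaw _ hab₂
  have hXY := tendsto_integral_sub_of_tendstoLaw hPσ (fun δ => YBWalk.measurable_of_top _)
    (hσL.continuous.measurable.comp_aemeasurable hΓ.aemeasurable) hconvσ hBL g
  -- assemble
  have h := hZ.add hXY
  rw [add_zero] at h
  refine h.congr fun δ => ?_
  have hq : ∫ γ, g γ.curve ∂(SAW.law (D.map (similarity I I_ne_zero 0)).carrier δ ![-(a δ 1), a δ 0]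
      ![-(b δ 1), b δ 0]) = ∫ γ, g (CurveClass.map (similarity I I_ne_zero 0 : C(ℂ, ℂ)) γ.curve)
        ∂(SAW.law D.carrier δ (a δ) (b δ)) :=
    integral_quarterTurn D.carrier δ (a δ) (b δ) g
  simp only [hg] at hq ⊢
  linarith [hq]

/-- **`HexSAWScalingLimit → K2∀ → YBLimitExists → AngleUniversality → YBtoUniform → LatticeUniversality`**: the
same over route SAWTrackTransport's items stmt-16995 ∧ stmt-16963 (landed reduction of the transport stub,
`thirdToSquareRobustBL_of_trackTransport`, p144803) and stmt-16966. [folklore] -/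
theorem latticeUniversality_of_hexConjecture_of_allForm_trackTransport (hA : HexSAWScalingLimit)
    (hK : (∀ (D : DobrushinDomain) (a b : ℝ → HexVertex), SAW.IsEmbEndpointApprox hexGraph hexCenter D a b → ∀ a' b' : ℝ → MidEdge, (∀ᶠ δ in 𝓝[>] (0 : ℝ), a' δ ≠ b' δ ∧ IsBdryEdge (meshFaces third (((D.map (similarity I I_ne_zero 0)).map (similarity 1 one_ne_zero (-(I * (δ : ℂ) / 2)))).carrier) δ) (a' δ) ∧ IsBdryEdge (meshFaces third (((D.map (similarity I I_ne_zero 0)).map (similarity 1 one_ne_zero (-(I * (δ : ℂ) / 2)))).carrier) δ) (b' δ) ∧ Nonempty (YangBaxterSAW third (((D.map (similarity I I_ne_zero 0)).map (similarity 1 one_ne_zero (-(I * (δ : ℂ) / 2)))).carrier) δ (a' δ) (b' δ))) → Tendsto (fun δ : ℝ => (δ : ℂ) * planeMidpoint third (a' δ)) (𝓝[>] (0 : ℝ)) (𝓝 ((D.map (similarity I I_ne_zero 0)).pt 0)) → Tendsto (fun δ : ℝ => (δ : ℂ) * planeMidpoint third (b' δ)) (𝓝[>] (0 : ℝ)) (𝓝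 ((D.map (similarity I I_ne_zero 0)).pt 1)) → ∀ f : BoundedContinuousFunction (CurveClass ℂ) ℝ, LipschitzWith 1 f → Tendsto (fun δ : ℝ => (∫ γ, f γ.curve ∂(SAW.hexSAWLaw (faceDomain (((D.map (similarity I I_ne_zero 0)).map (similarity 1 one_ne_zero (-(I * (δ : ℂ) / 2)))).carrier) δ (a' δ)) δ (bdryVertex (meshFaces third (((D.map (similarity I I_ne_zero 0)).map (similarity 1 one_ne_zero (-(I * (δ : ℂ) / 2)))).carrier) δ) (a' δ)) (bdryVertex (meshFaces third (((D.map (similarity I I_ne_zero 0)).map (similarity 1 one_ne_zero (-(I * (δ : ℂ) / 2)))).carrier) δ) (b' δ)))) - ∫ γ, f γ.curve ∂(SAW.hexSAWLaw D.carrier δ (a δ) (b δ))) (𝓝[>] (0 : ℝ)) (𝓝 0)))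
    (hL : SAWTrackTransport.YBLimitExists) (hAU : SAWTrackTransport.AngleUniversality)
    (h3 : SAWTrackTransport.YBtoUniform) : SAWMassiveIsingTilt.LatticeUniversality :=
  latticeUniversality_of_hexConjecture_of_allForm hA hK (thirdToSquareRobustBL_of_trackTransport hL hAU) h3

/-! ### One kernel for two cruxes: `HexTransfer` (stmt-14221) from K2∀, the transport and the toll -/

/-- **`K2∀ → ThirdToSquareRobustBL → YBtoUniform → HexTransfer`** (crux stmt-CriticalPhenomena-14221, route
`SAWPhaseRetrieval`'s spelling): `HexTransfer ↔ (HexSAWScalingLimit → LatticeUniversality)` unconditionally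
(`hexTransfer_iff_imp`, p106915), and the right-hand side is `latticeUniversality_of_hexConjecture_of_allForm`. So the
hex-only kernel K2∀ of THIS line closes the sibling crux's hexagonal end as well — no tightness item, no
(A)-conditional face-robustness stub. [folklore] -/
theorem hexTransfer_of_allForm
    (hK : (∀ (D : DobrushinDomain) (a b : ℝ → HexVertex), SAW.IsEmbEndpointApprox hexGraph hexCenter D a b → ∀ a' b' : ℝ → MidEdge, (∀ᶠ δ in 𝓝[>] (0 : ℝ), a' δ ≠ b' δ ∧ IsBdryEdge (meshFaces third (((D.map (similarity I I_ne_zero 0)).map (similarity 1 one_ne_zero (-(I * (δ : ℂ) / 2)))).carrier) δ) (a' δ) ∧ IsBdryEdge (meshFaces third (((D.map (similarity I I_ne_zero 0)).map (similarity 1 one_ne_zero (-(I * (δ : ℂ) / 2)))).carrier) δ) (b' δ) ∧ Nonempty (YangBaxterSAW third (((D.map (similarity I I_ne_zero 0)).map (similarity 1 one_ne_zero (-(I * (δ : ℂ) / 2)))).carrier) δ (a' δ) (b' δ))) → Tendsto (fun δ : ℝ => (δ : ℂ) * planeMidpoint third (a' δ)) (𝓝[>] (0 : ℝ)) (𝓝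 ((D.map (similarity I I_ne_zero 0)).pt 0)) → Tendsto (fun δ : ℝ => (δ : ℂ) * planeMidpoint third (b' δ)) (𝓝[>] (0 : ℝ)) (𝓝 ((D.map (similarity I I_ne_zero 0)).pt 1)) → ∀ f : BoundedContinuousFunction (CurveClass ℂ) ℝ, LipschitzWith 1 f → Tendsto (fun δ : ℝ => (∫ γ, f γ.curve ∂(SAW.hexSAWLaw (faceDomain (((D.map (similarity I I_ne_zero 0)).map (similarity 1 one_ne_zero (-(I * (δ : ℂ) / 2)))).carrier) δ (a' δ)) δ (bdryVertex (meshFaces third (((D.map (similarity I I_ne_zero 0)).map (similarity 1 one_ne_zero (-(I * (δ : ℂ) / 2)))).carrier) δ) (a' δ)) (bdryVertex (meshFaces third (((D.map (similarity I I_ne_zero 0)).map (similarity 1 one_ne_zero (-(I * (δ : ℂ) / 2)))).carrier) δ) (b' δ)))) - ∫ γ, f γ.curve ∂(SAW.hexSAWLaw D.carrier δ (a δ) (b δ))) (𝓝[>] (0 : ℝ)) (𝓝 0)))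
    (h2 : (∀ (D : DobrushinDomain) (u : ℝ → ℂ) (a b : ℝ → MidEdge), (∀ᶠ δ in 𝓝[>] (0 : ℝ), ‖u δ‖ ≤ δ) → (∀ᶠ δ in 𝓝[>] (0 : ℝ), Nonempty (YangBaxterSAW (fun (_ : ℤ) => Real.pi / 3) ((D.map (similarity 1 one_ne_zero (u δ))).carrier) δ (a δ) (b δ))) → Tendsto (fun δ : ℝ => (δ : ℂ) * planeMidpoint (fun (_ : ℤ) => Real.pi / 3) (a δ)) (𝓝[>] (0 : ℝ)) (𝓝 (D.pt 0)) → Tendsto (fun δ : ℝ => (δ : ℂ) * planeMidpoint (fun (_ : ℤ) => Real.pi / 3) (b δ)) (𝓝[>] (0 : ℝ)) (𝓝 (D.pt 1)) → ∃ a' b' : ℝ → MidEdge, IsYBEndpointApprox (fun (_ : ℤ) => Real.pi / 2) D a' b' ∧ ∀ f : BoundedContinuousFunction (CurveClass ℂ) ℝ, LipschitzWith 1 f → Tendsto (fun δ : ℝ => (∫ γ, f (γ.curve (fun (_ : ℤ) => Real.pi / 3) δ) ∂(ybLaw (fun (_ : ℤ) => Real.pi / 3) ((D.map (similarity 1 one_ne_zero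 (u δ))).carrier) δ 1 (a δ) (b δ))) - ∫ γ, f (γ.curve (fun (_ : ℤ) => Real.pi / 2) δ) ∂(ybLaw (fun (_ : ℤ) => Real.pi / 2) D.carrier δ 1 (a' δ) (b' δ))) (𝓝[>] (0 : ℝ)) (𝓝 0)))
    (h3 : SAWTrackTransport.YBtoUniform) : SAWPhaseRetrieval.HexTransfer :=
  Cruxes.HexTransfer.Sandwich.hexTransfer_iff_imp.2 fun hA =>
    latticeUniversality_of_hexConjecture_of_allForm hA hK h2 h3

/-- **`K2∀ → YBLimitExists → AngleUniversality → YBtoUniform → HexTransfer`**: crux 14221 from K2∀ and route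
SAWTrackTransport's items stmt-16995, 16963, 16966 — the SAME open set as the sibling line `yb_relay` v6 with its
research stub `stub_hexFaceRobustExists` replaced by this line's K2∀. [folklore] -/
theorem hexTransfer_of_allForm_trackTransport
    (hK : (∀ (D : DobrushinDomain) (a b : ℝ → HexVertex), SAW.IsEmbEndpointApprox hexGraph hexCenter D a b → ∀ a' b' : ℝ → MidEdge, (∀ᶠ δ in 𝓝[>] (0 : ℝ), a' δ ≠ b' δ ∧ IsBdryEdge (meshFaces third (((D.map (similarity I I_ne_zero 0)).map (similarity 1 one_ne_zero (-(I * (δ : ℂ) / 2)))).carrier) δ) (a' δ) ∧ IsBdryEdge (meshFaces third (((D.map (similarity I I_ne_zero 0)).map (similarity 1 one_ne_zero (-(I * (δ : ℂ) / 2)))).carrier) δ) (b' δ) ∧ Nonempty (YangBaxterSAW third (((D.map (similarity I I_ne_zero 0)).map (similarity 1 one_ne_zero (-(I * (δ : ℂ) / 2)))).carrier) δ (a' δ) (b' δ))) → Tendsto (fun δ : ℝ => (δ : ℂ) * planeMidpoint third (a' δ)) (𝓝[>] (0 : ℝ)) (𝓝 ((D.map (similarity I I_ne_zero 0)).pt 0))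 → Tendsto (fun δ : ℝ => (δ : ℂ) * planeMidpoint third (b' δ)) (𝓝[>] (0 : ℝ)) (𝓝 ((D.map (similarity I I_ne_zero 0)).pt 1)) → ∀ f : BoundedContinuousFunction (CurveClass ℂ) ℝ, LipschitzWith 1 f → Tendsto (fun δ : ℝ => (∫ γ, f γ.curve ∂(SAW.hexSAWLaw (faceDomain (((D.map (similarity I I_ne_zero 0)).map (similarity 1 one_ne_zero (-(I * (δ : ℂ) / 2)))).carrier) δ (a' δ)) δ (bdryVertex (meshFaces third (((D.map (similarity I I_ne_zero 0)).map (similarity 1 one_ne_zero (-(I * (δ : ℂ) / 2)))).carrier) δ) (a' δ)) (bdryVertex (meshFaces third (((D.map (similarity I I_ne_zero 0)).map (similarity 1 one_ne_zero (-(I * (δ : ℂ) / 2)))).carrier) δ) (b' δ)))) - ∫ γ, f γ.curve ∂(SAW.hexSAWLaw D.carrier δ (a δ) (b δ))) (𝓝[>] (0 : ℝ)) (𝓝 0)))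
    (hL : SAWTrackTransport.YBLimitExists) (hAU : SAWTrackTransport.AngleUniversality)
    (h3 : SAWTrackTransport.YBtoUniform) : SAWPhaseRetrieval.HexTransfer :=
  hexTransfer_of_allForm hK (thirdToSquareRobustBL_of_trackTransport hL hAU) h3

/-- The same for route `SAWDefectDecoherence`'s copy of `HexTransfer` (identical body). [folklore] -/
theorem hexTransfer_defectDecoherence_of_allForm
    (hK : (∀ (D : DobrushinDomain) (a b : ℝ → HexVertex), SAW.IsEmbEndpointApprox hexGraph hexCenter D a b → ∀ a' b' : ℝ → MidEdge, (∀ᶠ δ in 𝓝[>] (0 : ℝ), a' δ ≠ b' δ ∧ IsBdryEdge (meshFaces third (((D.map (similarity I I_ne_zero 0)).map (similarity 1 one_ne_zero (-(I * (δ : ℂ) / 2)))).carrier) δ) (a' δ) ∧ IsBdryEdge (meshFaces third (((D.map (similarity I I_ne_zero 0)).map (similarity 1 one_ne_zero (-(I * (δ : ℂ) / 2)))).carrier) δ) (b' δ) ∧ Nonempty (YangBaxterSAW third (((D.map (similarity I I_ne_zero 0)).map (similarity 1 one_ne_zero (-(I * (δ : ℂ) / 2)))).carrier) δ (a' δ)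 (b' δ))) → Tendsto (fun δ : ℝ => (δ : ℂ) * planeMidpoint third (a' δ)) (𝓝[>] (0 : ℝ)) (𝓝 ((D.map (similarity I I_ne_zero 0)).pt 0)) → Tendsto (fun δ : ℝ => (δ : ℂ) * planeMidpoint third (b' δ)) (𝓝[>] (0 : ℝ)) (𝓝 ((D.map (similarity I I_ne_zero 0)).pt 1)) → ∀ f : BoundedContinuousFunction (CurveClass ℂ) ℝ, LipschitzWith 1 f → Tendsto (fun δ : ℝ => (∫ γ, f γ.curve ∂(SAW.hexSAWLaw (faceDomain (((D.map (similarity I I_ne_zero 0)).map (similarity 1 one_ne_zero (-(I * (δ : ℂ) / 2)))).carrier) δ (a' δ)) δ (bdryVertex (meshFaces third (((D.map (similarity I I_ne_zero 0)).map (similarity 1 one_ne_zero (-(I * (δ : ℂ) / 2)))).carrier) δ) (a' δ)) (bdryVertex (meshFaces third (((D.map (similarity I I_ne_zero 0)).map (similarity 1 one_ne_zero (-(I * (δ : ℂ) / 2)))).carrier) δ) (b' δ)))) - ∫ γ, f γ.curve ∂(SAW.hexSAWLaw D.carrier δ (a δ) (b δ))) (𝓝[>] (0 : ℝ)) (𝓝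 0)))
    (h2 : (∀ (D : DobrushinDomain) (u : ℝ → ℂ) (a b : ℝ → MidEdge), (∀ᶠ δ in 𝓝[>] (0 : ℝ), ‖u δ‖ ≤ δ) → (∀ᶠ δ in 𝓝[>] (0 : ℝ), Nonempty (YangBaxterSAW (fun (_ : ℤ) => Real.pi / 3) ((D.map (similarity 1 one_ne_zero (u δ))).carrier) δ (a δ) (b δ))) → Tendsto (fun δ : ℝ => (δ : ℂ) * planeMidpoint (fun (_ : ℤ) => Real.pi / 3) (a δ)) (𝓝[>] (0 : ℝ)) (𝓝 (D.pt 0)) → Tendsto (fun δ : ℝ => (δ : ℂ) * planeMidpoint (fun (_ : ℤ) => Real.pi / 3) (b δ)) (𝓝[>] (0 : ℝ)) (𝓝 (D.pt 1)) → ∃ a' b' : ℝ → MidEdge, IsYBEndpointApprox (fun (_ : ℤ) => Real.pi / 2) D a' b' ∧ ∀ f : BoundedContinuousFunction (CurveClass ℂ) ℝ, LipschitzWith 1 f → Tendsto (fun δ : ℝ => (∫ γ, f (γ.curve (fun (_ : ℤ) => Real.pi / 3) δ) ∂(ybLaw (fun (_ : ℤ) => Real.pi / 3) ((D.map (similarity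 1 one_ne_zero (u δ))).carrier) δ 1 (a δ) (b δ))) - ∫ γ, f (γ.curve (fun (_ : ℤ) => Real.pi / 2) δ) ∂(ybLaw (fun (_ : ℤ) => Real.pi / 2) D.carrier δ 1 (a' δ) (b' δ))) (𝓝[>] (0 : ℝ)) (𝓝 0)))
    (h3 : SAWTrackTransport.YBtoUniform) : SAWDefectDecoherence.HexTransfer :=
  hexTransfer_of_allForm hK h2 h3

/-- The same for route `SAWWindingAlias`'s copy of `HexTransfer` (identical body). [folklore] -/
theorem hexTransfer_windingAlias_of_allForm
    (hK : (∀ (D : DobrushinDomain) (a b : ℝ → HexVertex), SAW.IsEmbEndpointApprox hexGraph hexCenter D a b → ∀ a' b' : ℝ → MidEdge, (∀ᶠ δ in 𝓝[>] (0 : ℝ), a' δ ≠ b' δ ∧ IsBdryEdge (meshFaces third (((D.map (similarity I I_ne_zero 0)).map (similarity 1 one_ne_zero (-(I * (δ : ℂ) / 2)))).carrier) δ) (a' δ) ∧ IsBdryEdge (meshFaces third (((D.map (similarity I I_ne_zero 0)).map (similarity 1 one_ne_zero (-(I * (δ : ℂ) / 2)))).carrier) δ) (b' δ) ∧ Nonempty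 (YangBaxterSAW third (((D.map (similarity I I_ne_zero 0)).map (similarity 1 one_ne_zero (-(I * (δ : ℂ) / 2)))).carrier) δ (a' δ) (b' δ))) → Tendsto (fun δ : ℝ => (δ : ℂ) * planeMidpoint third (a' δ)) (𝓝[>] (0 : ℝ)) (𝓝 ((D.map (similarity I I_ne_zero 0)).pt 0)) → Tendsto (fun δ : ℝ => (δ : ℂ) * planeMidpoint third (b' δ)) (𝓝[>] (0 : ℝ)) (𝓝 ((D.map (similarity I I_ne_zero 0)).pt 1)) → ∀ f : BoundedContinuousFunction (CurveClass ℂ) ℝ, LipschitzWith 1 f → Tendsto (fun δ : ℝ => (∫ γ, f γ.curve ∂(SAW.hexSAWLaw (faceDomain (((D.map (similarity I I_ne_zero 0)).map (similarity 1 one_ne_zero (-(I * (δ : ℂ) / 2)))).carrier) δ (a' δ)) δ (bdryVertex (meshFaces third (((D.map (similarity I I_ne_zero 0)).map (similarity 1 one_ne_zero (-(I * (δ : ℂ) / 2)))).carrier) δ) (a' δ)) (bdryVertex (meshFaces third (((D.map (similarity I I_ne_zero 0)).map (similarity 1 one_ne_zero (-(I * (δ : ℂ) / 2)))).carrier) δ)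 (b' δ)))) - ∫ γ, f γ.curve ∂(SAW.hexSAWLaw D.carrier δ (a δ) (b δ))) (𝓝[>] (0 : ℝ)) (𝓝 0)))
    (h2 : (∀ (D : DobrushinDomain) (u : ℝ → ℂ) (a b : ℝ → MidEdge), (∀ᶠ δ in 𝓝[>] (0 : ℝ), ‖u δ‖ ≤ δ) → (∀ᶠ δ in 𝓝[>] (0 : ℝ), Nonempty (YangBaxterSAW (fun (_ : ℤ) => Real.pi / 3) ((D.map (similarity 1 one_ne_zero (u δ))).carrier) δ (a δ) (b δ))) → Tendsto (fun δ : ℝ => (δ : ℂ) * planeMidpoint (fun (_ : ℤ) => Real.pi / 3) (a δ)) (𝓝[>] (0 : ℝ)) (𝓝 (D.pt 0)) → Tendsto (fun δ : ℝ => (δ : ℂ) * planeMidpoint (fun (_ : ℤ) => Real.pi / 3) (b δ)) (𝓝[>] (0 : ℝ)) (𝓝 (D.pt 1)) → ∃ a' b' : ℝ → MidEdge, IsYBEndpointApprox (fun (_ : ℤ) => Real.pi / 2) D a' b' ∧ ∀ f : BoundedContinuousFunction (CurveClass ℂ) ℝ, LipschitzWith 1 f → Tendsto (fun δ : ℝ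 => (∫ γ, f (γ.curve (fun (_ : ℤ) => Real.pi / 3) δ) ∂(ybLaw (fun (_ : ℤ) => Real.pi / 3) ((D.map (similarity 1 one_ne_zero (u δ))).carrier) δ 1 (a δ) (b δ))) - ∫ γ, f (γ.curve (fun (_ : ℤ) => Real.pi / 2) δ) ∂(ybLaw (fun (_ : ℤ) => Real.pi / 2) D.carrier δ 1 (a' δ) (b' δ))) (𝓝[>] (0 : ℝ)) (𝓝 0)))
    (h3 : SAWTrackTransport.YBtoUniform) : SAWWindingAlias.HexTransfer :=
  hexTransfer_of_allForm hK h2 h3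

/-- The same for route `SAWDevelopingMap`'s copy of `HexTransfer` (identical body). [folklore] -/
theorem hexTransfer_developingMap_of_allForm
    (hK : (∀ (D : DobrushinDomain) (a b : ℝ → HexVertex), SAW.IsEmbEndpointApprox hexGraph hexCenter D a b → ∀ a' b' : ℝ → MidEdge, (∀ᶠ δ in 𝓝[>] (0 : ℝ), a' δ ≠ b' δ ∧ IsBdryEdge (meshFaces third (((D.map (similarity I I_ne_zero 0)).map (similarity 1 one_ne_zero (-(I * (δ : ℂ) / 2)))).carrier) δ) (a' δ) ∧ IsBdryEdge (meshFaces third (((D.map (similarity I I_ne_zero 0)).map (similarity 1 one_ne_zero (-(I * (δ : ℂ) / 2)))).carrier) δ) (b' δ) ∧ Nonempty (YangBaxterSAW third (((D.map (similarity I I_ne_zero 0)).map (similarity 1 one_ne_zero (-(I * (δ : ℂ) / 2)))).carrier) δ (a' δ) (b' δ))) → Tendsto (fun δ : ℝ => (δ : ℂ) * planeMidpoint third (a' δ)) (𝓝[>] (0 : ℝ)) (𝓝 ((D.map (similarity I I_ne_zero 0)).pt 0)) → Tendsto (fun δ : ℝ => (δ : ℂ) * planeMidpoint third (b' δ)) (𝓝[>]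 (0 : ℝ)) (𝓝 ((D.map (similarity I I_ne_zero 0)).pt 1)) → ∀ f : BoundedContinuousFunction (CurveClass ℂ) ℝ, LipschitzWith 1 f → Tendsto (fun δ : ℝ => (∫ γ, f γ.curve ∂(SAW.hexSAWLaw (faceDomain (((D.map (similarity I I_ne_zero 0)).map (similarity 1 one_ne_zero (-(I * (δ : ℂ) / 2)))).carrier) δ (a' δ)) δ (bdryVertex (meshFaces third (((D.map (similarity I I_ne_zero 0)).map (similarity 1 one_ne_zero (-(I * (δ : ℂ) / 2)))).carrier) δ) (a' δ)) (bdryVertex (meshFaces third (((D.map (similarity I I_ne_zero 0)).map (similarity 1 one_ne_zero (-(I * (δ : ℂ) / 2)))).carrier) δ) (b' δ)))) - ∫ γ, f γ.curve ∂(SAW.hexSAWLaw D.carrier δ (a δ) (b δ))) (𝓝[>] (0 : ℝ)) (𝓝 0)))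
    (h2 : (∀ (D : DobrushinDomain) (u : ℝ → ℂ) (a b : ℝ → MidEdge), (∀ᶠ δ in 𝓝[>] (0 : ℝ), ‖u δ‖ ≤ δ) → (∀ᶠ δ in 𝓝[>] (0 : ℝ), Nonempty (YangBaxterSAW (fun (_ : ℤ) => Real.pi / 3) ((D.map (similarity 1 one_ne_zero (u δ))).carrier) δ (a δ) (b δ))) → Tendsto (fun δ : ℝ => (δ : ℂ) * planeMidpoint (fun (_ : ℤ) => Real.pi / 3) (a δ)) (𝓝[>] (0 : ℝ)) (𝓝 (D.pt 0)) → Tendsto (fun δ : ℝ => (δ : ℂ) * planeMidpoint (fun (_ : ℤ) => Real.pi / 3) (b δ)) (𝓝[>] (0 : ℝ)) (𝓝 (D.pt 1)) → ∃ a' b' : ℝ → MidEdge, IsYBEndpointApprox (fun (_ : ℤ) => Real.pi / 2) D a' b' ∧ ∀ f : BoundedContinuousFunction (CurveClass ℂ) ℝ, LipschitzWith 1 f → Tendsto (fun δ : ℝ => (∫ γ, f (γ.curve (fun (_ : ℤ) => Real.pi / 3) δ) ∂(ybLaw (fun (_ : ℤ) => Real.pi / 3) ((D.map (similarity 1 one_ne_zero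 (u δ))).carrier) δ 1 (a δ) (b δ))) - ∫ γ, f (γ.curve (fun (_ : ℤ) => Real.pi / 2) δ) ∂(ybLaw (fun (_ : ℤ) => Real.pi / 2) D.carrier δ 1 (a' δ) (b' δ))) (𝓝[>] (0 : ℝ)) (𝓝 0)))
    (h3 : SAWTrackTransport.YBtoUniform) : SAWDevelopingMap.HexTransfer :=
  hexTransfer_of_allForm hK h2 h3

/-! ### Registered sub-goals (arrow form, for `--supports stmt-CriticalPhenomena-0807`) -/

/-- **Registered sub-goal** `hexTransfer_of_allFormRelay`: K2∀ → `YBLimitExists` (stmt-16995) → `AngleUniversality`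
(stmt-16963) → `YBtoUniform` (stmt-16966) → `HexTransfer` (stmt-14221) — crux 14221 from this line's hex-only kernel and
route SAWTrackTransport's three items, no tightness, no (A)-conditional face stub. [folklore] -/
theorem hexTransfer_of_allFormRelay : (∀ (D : DobrushinDomain) (a b : ℝ → HexVertex), SAW.IsEmbEndpointApprox hexGraph hexCenter D a b → ∀ a' b' : ℝ → MidEdge, (∀ᶠ δ in 𝓝[>] (0 : ℝ), a' δ ≠ b' δ ∧ IsBdryEdge (meshFaces third (((D.map (similarity I I_ne_zero 0)).map (similarity 1 one_ne_zero (-(I * (δ : ℂ) / 2)))).carrier) δ) (a' δ) ∧ IsBdryEdge (meshFaces third (((D.map (similarity I I_ne_zero 0)).map (similarity 1 one_ne_zero (-(I * (δ : ℂ) / 2)))).carrier) δ) (b' δ) ∧ Nonempty (YangBaxterSAW third (((D.map (similarity I I_ne_zero 0)).map (similarity 1 one_ne_zero (-(I * (δ : ℂ) / 2)))).carrier) δ (a' δ) (b' δ))) → Tendsto (fun δ : ℝ => (δ : ℂ) * planeMidpoint third (a' δ)) (𝓝[>] (0 : ℝ)) (𝓝 ((D.map (similarity I I_ne_zero 0)).pt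 0)) → Tendsto (fun δ : ℝ => (δ : ℂ) * planeMidpoint third (b' δ)) (𝓝[>] (0 : ℝ)) (𝓝 ((D.map (similarity I I_ne_zero 0)).pt 1)) → ∀ f : BoundedContinuousFunction (CurveClass ℂ) ℝ, LipschitzWith 1 f → Tendsto (fun δ : ℝ => (∫ γ, f γ.curve ∂(SAW.hexSAWLaw (faceDomain (((D.map (similarity I I_ne_zero 0)).map (similarity 1 one_ne_zero (-(I * (δ : ℂ) / 2)))).carrier) δ (a' δ)) δ (bdryVertex (meshFaces third (((D.map (similarity I I_ne_zero 0)).map (similarity 1 one_ne_zero (-(I * (δ : ℂ) / 2)))).carrier) δ) (a' δ)) (bdryVertex (meshFaces third (((D.map (similarity I I_ne_zero 0)).map (similarity 1 one_ne_zero (-(I * (δ : ℂ) / 2)))).carrier) δ) (b' δ)))) - ∫ γ, f γ.curve ∂(SAW.hexSAWLaw D.carrier δ (a δ) (b δ))) (𝓝[>] (0 : ℝ)) (𝓝 0)) → SAWTrackTransport.YBLimitExists → SAWTrackTransport.AngleUniversality → SAWTrackTransport.YBtoUniform → SAWPhaseRetrieval.HexTransfer :=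
  fun hK hL hAU h3 => hexTransfer_of_allForm_trackTransport hK hL hAU h3

/-- **Registered sub-goal** `latticeUniversality_of_hexConjecture_allFormRelay`: (A) → K2∀ → `YBLimitExists` →
`AngleUniversality` → `YBtoUniform` → `LatticeUniversality` — the crux from (A) (stmt-0808) in place of `HexTight`
(stmt-5423); compare `latticeUniversality_of_allFormRelay` (p150118): `HexTight → K2∀ → … → LatticeUniversality`.
[folklore] -/
theorem latticeUniversality_of_hexConjecture_allFormRelay : HexSAWScalingLimit → (∀ (D : DobrushinDomain) (a b : ℝ → HexVertex), SAW.IsEmbEndpointApprox hexGraph hexCenter D a b → ∀ a' b' : ℝ → MidEdge, (∀ᶠ δ in 𝓝[>] (0 : ℝ), a' δ ≠ b' δ ∧ IsBdryEdge (meshFaces third (((D.map (similarity I I_ne_zero 0)).map (similarity 1 one_ne_zero (-(I * (δ : ℂ) / 2)))).carrier) δ) (a' δ) ∧ IsBdryEdge (meshFaces third (((D.map (similarity I I_ne_zero 0)).map (similarity 1 one_ne_zero (-(I * (δ : ℂ) / 2)))).carrier) δ) (b' δ) ∧ Nonempty (YangBaxterSAW third (((D.map (similarity I I_ne_zero 0)).map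 (similarity 1 one_ne_zero (-(I * (δ : ℂ) / 2)))).carrier) δ (a' δ) (b' δ))) → Tendsto (fun δ : ℝ => (δ : ℂ) * planeMidpoint third (a' δ)) (𝓝[>] (0 : ℝ)) (𝓝 ((D.map (similarity I I_ne_zero 0)).pt 0)) → Tendsto (fun δ : ℝ => (δ : ℂ) * planeMidpoint third (b' δ)) (𝓝[>] (0 : ℝ)) (𝓝 ((D.map (similarity I I_ne_zero 0)).pt 1)) → ∀ f : BoundedContinuousFunction (CurveClass ℂ) ℝ, LipschitzWith 1 f → Tendsto (fun δ : ℝ => (∫ γ, f γ.curve ∂(SAW.hexSAWLaw (faceDomain (((D.map (similarity I I_ne_zero 0)).map (similarity 1 one_ne_zero (-(I * (δ : ℂ) / 2)))).carrier) δ (a' δ)) δ (bdryVertex (meshFaces third (((D.map (similarity I I_ne_zero 0)).map (similarity 1 one_ne_zero (-(I * (δ : ℂ) / 2)))).carrier) δ) (a' δ)) (bdryVertex (meshFaces third (((D.map (similarity I I_ne_zero 0)).map (similarity 1 one_ne_zero (-(I * (δ : ℂ) / 2)))).carrier) δ) (b' δ)))) - ∫ γ, f γ.curve ∂(SAW.hexSAWLaw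 D.carrier δ (a δ) (b δ))) (𝓝[>] (0 : ℝ)) (𝓝 0)) → SAWTrackTransport.YBLimitExists → SAWTrackTransport.AngleUniversality → SAWTrackTransport.YBtoUniform → SAWMassiveIsingTilt.LatticeUniversality :=
  fun hA hK hL hAU h3 => latticeUniversality_of_hexConjecture_of_allForm_trackTransport hA hK hL hAU h3

end Summit.CriticalPhenomena.SAWScalingLimit.Cruxes.LatticeUniversality.Birth

end
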